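import Summits.HubbardSuperconductivity.HubbardSuperconductivity.Theorems.AnisotropyChordTransferFibre3TwoHoleBSNear
import Mathlib.NumberTheory.Harmonic.Bounds
import Mathlib.Analysis.SpecialFunctions.Pow.Asymptotics

/-!
# Route `AnisotropyChord` / H0 rotor rung: the near-pair tail certificate AT INFINITE CAPACITY — HOLE₂(.75) for `(z, z + d)` and every `L` past two explicit scalar thresholds, from three `L`-free facts about the ℤ² skeleton

Ninth file of the `TwoHoleBS` chain (memo ROTOR-THEORY-21 §317(d), §324(f)).  In `…Fibre3TwoHoleBSNear.dualCert_threeQuarter_near` the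
capacity parameter `Λup ≥ 4H_{⌊L/2⌋}` still enters the skeleton hypotheses through `twoHoleP (skelA d) Λup` and `smInv (skelA d) Λup`.
The two-hole CAPACITY DECOMPOSITION (the analogue of PartN40's `capacity_decomposition`) removes it:
* `twoHolePinf A` (`P∞ = −(A⁻¹)_BB + x_B x_Bᵀ/s − ½`), `smInvInf A` (`E∞ = −A⁻¹ + x xᵀ/s`);
* ★ `twoHoleP_eq_inf` (`P(Λ) = P∞ + x_B x_Bᵀ/(s(Λs − 1))`), `smInv_eq_inf` (`E(Λ) = E∞ + x xᵀ/(s(Λs − 1))`),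
  `twoHoleP_quad_eq_inf` (`wᵀP(Λ)w = wᵀP∞w + (x_B·w)²/(s(Λs−1))`), `twoHoleP_quad_ge_inf` (`⪰` when `s > 0`, `Λs > 1`),
  `smInv_mulVec_eq_inf`, `l1_smInv_le` (`Σ|E(Λ)ŵ| ≤ Ninf(w)` when `s > 0`, `Λs ≥ 2`), `Ninf`;
* ★★★ `dualCert_threeQuarter_near_inf`: for `8 ≤ L`, any `z`, any offset `d`: if `skelA d` is invertible, `s = svec2 (skelA d) > 0`,
  `ε₀·Ninf(w)² ≤ wᵀ P∞ w` for all `w` (ONE `L`-free margin inequality on the explicit ℤ² skeleton, `ε₀ > 0` free), and `L` satisfies the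
  two scalar conditions `ε(L,d) ≤ ε₀` (`ε(L,d) = 2ρmax(11.71 ln L + 5.9)/L² + 4C₀ρmax/L → 0`) and `4H_{⌊L/2⌋}·s ≥ 2` (`H → ∞`), then
  `DualCert L (¾ε₁) z (z + d)`.
Prover seat `hubbard-h0-rotor-p2` g2; helper for stmt-HubbardSuperconductivity-19089 (`--supports`, helper class).
WHAT THIS IS NOT: nothing here proves superconductivity in the Hubbard model; the rotor TARGET as originally worded stays
FALSE (g15 verdict).  HOLE₂(.75) for NEAR pairs past an explicit (astronomically large, constants crude) threshold is reduced to
`L`-free numerics on an explicit ℤ² matrix whose entries are affine in transcendental window values; far pairs and small `L` remain.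
Mathlib + tree imports only; no sorry, no axioms.
-/

set_option linter.dupNamespace false

noncomputable section

open scoped BigOperators
open Complex Finset

namespace Summit.HubbardSuperconductivity.HubbardSuperconductivity.Theorems.AnisotropyChord.Transfer.Fibre3

namespace TwoHoleBS

variable (L : ℕ) [NeZero L]

/-! ## The capacity decomposition for two holes -/

/-- the two-hole map at infinite capacity, `P∞ = −(A⁻¹)_BB + x_B x_Bᵀ/s − ½·1`. [folklore] -/
def twoHolePinf (A : Matrix (Fin 5 ⊕ Fin 5) (Fin 5 ⊕ Fin 5) ℝ) : Matrix (Fin 4 ⊕ Fin 4) (Fin 4 ⊕ Fin 4) ℝ :=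
  Matrix.of fun i j => -(A⁻¹) (TwoChannel.emb i) (TwoChannel.emb j)
    + TwoChannel.xvec2 A (TwoChannel.emb i) * TwoChannel.xvec2 A (TwoChannel.emb j) / TwoChannel.svec2 A
    - (if i = j then (1 : ℝ) / 2 else 0)

/-- the charge map at infinite capacity, `E∞ = −A⁻¹ + x xᵀ/s`. [folklore] -/
def smInvInf (A : Matrix (Fin 5 ⊕ Fin 5) (Fin 5 ⊕ Fin 5) ℝ) : Matrix (Fin 5 ⊕ Fin 5) (Fin 5 ⊕ Fin 5) ℝ :=
  -A⁻¹ + (1 / TwoChannel.svec2 A) • Matrix.vecMulVec (TwoChannel.xvec2 A) (TwoChannel.xvec2 A)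

/-- ★ CAPACITY DECOMPOSITION (two holes): `P(Λ)_{ij} = P∞_{ij} + x_i x_j/(s(Λs − 1))`. [folklore] -/
theorem twoHoleP_eq_inf (A : Matrix (Fin 5 ⊕ Fin 5) (Fin 5 ⊕ Fin 5) ℝ) (Λ : ℝ) (hs : TwoChannel.svec2 A ≠ 0)
    (hΛ : Λ * TwoChannel.svec2 A - 1 ≠ 0) (i j : Fin 4 ⊕ Fin 4) :
    TwoChannel.twoHoleP A Λ i j = twoHolePinf A i j
      + TwoChannel.xvec2 A (TwoChannel.emb i) * TwoChannel.xvec2 A (TwoChannel.emb j)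
          / (TwoChannel.svec2 A * (Λ * TwoChannel.svec2 A - 1)) := by
  simp only [TwoChannel.twoHoleP, twoHolePinf, Matrix.of_apply]
  field_simp
  ring

/-- the charge map decomposes the same way: `E(Λ)_{pq} = E∞_{pq} + x_p x_q/(s(Λs − 1))`. [folklore] -/
theorem smInv_eq_inf (A : Matrix (Fin 5 ⊕ Fin 5) (Fin 5 ⊕ Fin 5) ℝ) (Λ : ℝ) (hs : TwoChannel.svec2 A ≠ 0)
    (hΛ : Λ * TwoChannel.svec2 A - 1 ≠ 0) (p q : Fin 5 ⊕ Fin 5) :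
    smInv A Λ p q = smInvInf A p q
      + TwoChannel.xvec2 A p * TwoChannel.xvec2 A q / (TwoChannel.svec2 A * (Λ * TwoChannel.svec2 A - 1)) := by
  simp only [smInv, smInvInf, Matrix.add_apply, Matrix.smul_apply, Matrix.vecMulVec_apply, smul_eq_mul, Matrix.neg_apply]
  field_simp
  ring

/-- the quadratic form: `wᵀP(Λ)w = wᵀP∞w + (x_B·w)²/(s(Λs − 1))`. [folklore] -/
theorem twoHoleP_quad_eq_inf (A : Matrix (Fin 5 ⊕ Fin 5) (Fin 5 ⊕ Fin 5) ℝ) (Λ : ℝ) (hs : TwoChannel.svec2 A ≠ 0)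
    (hΛ : Λ * TwoChannel.svec2 A - 1 ≠ 0) (w : Fin 4 ⊕ Fin 4 → ℝ) :
    dotProduct w ((TwoChannel.twoHoleP A Λ).mulVec w)
      = dotProduct w ((twoHolePinf A).mulVec w)
        + (∑ i, TwoChannel.xvec2 A (TwoChannel.emb i) * w i) ^ 2 / (TwoChannel.svec2 A * (Λ * TwoChannel.svec2 A - 1)) := by
  set D := TwoChannel.svec2 A * (Λ * TwoChannel.svec2 A - 1) with hD
  set S := ∑ i, TwoChannel.xvec2 A (TwoChannel.emb i) * w i with hS
  have hrow : ∀ i, (TwoChannel.twoHoleP A Λ).mulVec w i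
      = (twoHolePinf A).mulVec w i + TwoChannel.xvec2 A (TwoChannel.emb i) * S / D := by
    intro i
    simp only [Matrix.mulVec, dotProduct]
    rw [Finset.sum_congr rfl fun j _ => by rw [twoHoleP_eq_inf A Λ hs hΛ i j], hS, Finset.mul_sum, Finset.sum_div,
      ← Finset.sum_add_distrib]
    refine Finset.sum_congr rfl fun j _ => ?_
    rw [hD]
    ring
  simp only [dotProduct]
  rw [Finset.sum_congr rfl fun i _ => by rw [hrow i], hS]
  simp only [mul_add, Finset.sum_add_distrib]
  congr 1
  rw [sq, Finset.sum_mul, Finset.sum_div]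
  refine Finset.sum_congr rfl fun i _ => ?_
  ring

/-- ★ `P(Λ) ⪰ P∞` when `s > 0` and `Λs > 1`. [folklore] -/
theorem twoHoleP_quad_ge_inf (A : Matrix (Fin 5 ⊕ Fin 5) (Fin 5 ⊕ Fin 5) ℝ) (Λ : ℝ) (hs : 0 < TwoChannel.svec2 A)
    (hΛ : 1 < Λ * TwoChannel.svec2 A) (w : Fin 4 ⊕ Fin 4 → ℝ) :
    dotProduct w ((twoHolePinf A).mulVec w) ≤ dotProduct w ((TwoChannel.twoHoleP A Λ).mulVec w) := by
  rw [twoHoleP_quad_eq_inf A Λ hs.ne' (by linarith) w]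
  have hD : 0 < TwoChannel.svec2 A * (Λ * TwoChannel.svec2 A - 1) := mul_pos hs (by linarith)
  have := div_nonneg (sq_nonneg (∑ i, TwoChannel.xvec2 A (TwoChannel.emb i) * w i)) hD.le
  linarith

/-- the charge vector: `E(Λ)v = E∞ v + (x·v)/(s(Λs−1))·x`. [folklore] -/
theorem smInv_mulVec_eq_inf (A : Matrix (Fin 5 ⊕ Fin 5) (Fin 5 ⊕ Fin 5) ℝ) (Λ : ℝ) (hs : TwoChannel.svec2 A ≠ 0)
    (hΛ : Λ * TwoChannel.svec2 A - 1 ≠ 0) (v : Fin 5 ⊕ Fin 5 → ℝ) (p : Fin 5 ⊕ Fin 5) :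
    (smInv A Λ).mulVec v p = (smInvInf A).mulVec v p
      + TwoChannel.xvec2 A p * (∑ q, TwoChannel.xvec2 A q * v q) / (TwoChannel.svec2 A * (Λ * TwoChannel.svec2 A - 1)) := by
  simp only [Matrix.mulVec, dotProduct]
  rw [Finset.sum_congr rfl fun q _ => by rw [smInv_eq_inf A Λ hs hΛ p q], Finset.mul_sum, Finset.sum_div,
    ← Finset.sum_add_distrib]
  refine Finset.sum_congr rfl fun q _ => ?_
  ring

/-- the `L`-free majorant of the charge `ℓ¹` norm: `Ninf(w) = Σ_p |(E∞ ŵ)_p| + |x·ŵ|·(Σ_p |x_p|)/s`, `ŵ = pad w`. [folklore] -/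
def Ninf (A : Matrix (Fin 5 ⊕ Fin 5) (Fin 5 ⊕ Fin 5) ℝ) (w : Fin 4 ⊕ Fin 4 → ℝ) : ℝ :=
  (∑ p, |(smInvInf A).mulVec (pad w) p|)
    + |∑ q, TwoChannel.xvec2 A q * pad w q| * (∑ p, |TwoChannel.xvec2 A p|) / TwoChannel.svec2 A

/-- ★ for `s > 0` and `Λs ≥ 2`: `Σ_p |(E(Λ) ŵ)_p| ≤ Ninf(w)`. [folklore] -/
theorem l1_smInv_le (A : Matrix (Fin 5 ⊕ Fin 5) (Fin 5 ⊕ Fin 5) ℝ) (Λ : ℝ) (hs : 0 < TwoChannel.svec2 A)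
    (hΛ : 2 ≤ Λ * TwoChannel.svec2 A) (w : Fin 4 ⊕ Fin 4 → ℝ) :
    ∑ p, |(smInv A Λ).mulVec (pad w) p| ≤ Ninf A w := by
  set s := TwoChannel.svec2 A with hsdef
  set D := s * (Λ * s - 1) with hD
  set S := ∑ q, TwoChannel.xvec2 A q * pad w q with hS
  have hD1 : s ≤ D := by
    rw [hD]
    have : 1 ≤ Λ * s - 1 := by linarith
    nlinarith
  have hDpos : 0 < D := lt_of_lt_of_le hs hD1
  have hterm : ∀ p, |(smInv A Λ).mulVec (pad w) p|
      ≤ |(smInvInf A).mulVec (pad w) p| + |TwoChannel.xvec2 A p| * |S| / D := by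
    intro p
    rw [smInv_mulVec_eq_inf A Λ hs.ne' (by linarith) (pad w) p, ← hsdef, ← hD, ← hS]
    refine (abs_add_le _ _).trans ?_
    rw [abs_div, abs_mul, abs_of_pos hDpos]
  refine (Finset.sum_le_sum fun p _ => hterm p).trans ?_
  rw [Finset.sum_add_distrib]
  unfold Ninf
  rw [← hsdef, ← hS]
  have hsum : ∑ p, |TwoChannel.xvec2 A p| * |S| / D = |S| * (∑ p, |TwoChannel.xvec2 A p|) / D := by
    rw [Finset.mul_sum, Finset.sum_div]
    refine Finset.sum_congr rfl fun p _ => ?_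
    ring
  rw [hsum]
  have hnum : 0 ≤ |S| * ∑ p, |TwoChannel.xvec2 A p| := mul_nonneg (abs_nonneg _) (Finset.sum_nonneg fun p _ => abs_nonneg _)
  have := div_le_div_of_nonneg_left hnum hs hD1
  linarith

/-! ## The near-pair certificate at infinite capacity -/

/-- ★★★ **NEAR-PAIR TAIL CERTIFICATE, `L`-FREE SKELETON FORM:** for `8 ≤ L`, any `z`, any integer offset `d` and any `ε₀`: if the
explicit ℤ² skeleton `skelA d` is invertible with `s = svec2 (skelA d) > 0` and satisfies the ONE margin inequality
`ε₀·Ninf(w)² ≤ wᵀ·P∞·w` (`P∞ = twoHolePinf (skelA d)`), and `L` is past the two scalar thresholds `ε(L,d) ≤ ε₀`,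
`4H_{⌊L/2⌋}·s ≥ 2`, then `DualCert L (¾ε₁) z (z + d)` (capacity `Λup = 4H_{⌊L/2⌋}`, `capT_le_harmonic`; `P(Λ) ⪰ P∞`,
`Σ|E(Λ)ŵ| ≤ Ninf`). [folklore] -/
theorem dualCert_threeQuarter_near_inf (hL : 8 ≤ L) (z : Tor L) (d : ℤ × ℤ) (ε₀ : ℝ)
    (hA : IsUnit (skelA d).det) (hs : 0 < TwoChannel.svec2 (skelA d))
    (hcap : 2 ≤ 4 * (harmonic (L / 2) : ℝ) * TwoChannel.svec2 (skelA d))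
    (hε : 2 * (rhoMax d * (11.71 * Real.log L + 5.9) / (L : ℝ) ^ 2)
          + 4 * (((15 / 2 * (Real.pi ^ 2 / 2 + Real.pi ^ 4 / 4) + 3 * Real.pi ^ 2 / 16)) * rhoMax d) / L ≤ ε₀)
    (hpos : ∀ w : Fin 4 ⊕ Fin 4 → ℝ,
      ε₀ * (Ninf (skelA d) w) ^ 2 ≤ dotProduct w ((twoHolePinf (skelA d)).mulVec w)) :
    DualCert L (3 / 4 * eps1 L) z (z + castPt L d) := by
  have hL1 : (1 : ℝ) ≤ L := by exact_mod_cast (show 1 ≤ L by omega)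
  have hlog : 0 ≤ 11.71 * Real.log L + 5.9 := by
    have := Real.log_nonneg hL1
    positivity
  have hρ := rhoMax_nonneg d
  have hεnn : 0 ≤ 2 * (rhoMax d * (11.71 * Real.log L + 5.9) / (L : ℝ) ^ 2)
      + 4 * (((15 / 2 * (Real.pi ^ 2 / 2 + Real.pi ^ 4 / 4) + 3 * Real.pi ^ 2 / 16)) * rhoMax d) / L := by positivity
  have hΛs : 1 < 4 * (harmonic (L / 2) : ℝ) * TwoChannel.svec2 (skelA d) := by linarith
  refine dualCert_threeQuarter_near L hL z d (4 * (harmonic (L / 2) : ℝ)) hA le_rfl (by linarith) fun w => ?_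
  have h1 := l1_smInv_le (skelA d) (4 * (harmonic (L / 2) : ℝ)) hs hcap w
  have h0 : 0 ≤ ∑ p, |(smInv (skelA d) (4 * (harmonic (L / 2) : ℝ))).mulVec (pad w) p| :=
    Finset.sum_nonneg fun p _ => abs_nonneg _
  have h2 : (∑ p, |(smInv (skelA d) (4 * (harmonic (L / 2) : ℝ))).mulVec (pad w) p|) ^ 2 ≤ (Ninf (skelA d) w) ^ 2 :=
    pow_le_pow_left₀ h0 h1 2
  have h3 := twoHoleP_quad_ge_inf (skelA d) (4 * (harmonic (L / 2) : ℝ)) hs hΛs w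
  have h4 := hpos w
  have hN : 0 ≤ (Ninf (skelA d) w) ^ 2 := sq_nonneg _
  calc _ ≤ (2 * (rhoMax d * (11.71 * Real.log L + 5.9) / (L : ℝ) ^ 2)
          + 4 * (((15 / 2 * (Real.pi ^ 2 / 2 + Real.pi ^ 4 / 4) + 3 * Real.pi ^ 2 / 16)) * rhoMax d) / L)
          * (Ninf (skelA d) w) ^ 2 := mul_le_mul_of_nonneg_left h2 hεnn
    _ ≤ ε₀ * (Ninf (skelA d) w) ^ 2 := mul_le_mul_of_nonneg_right hε hN
    _ ≤ _ := h4.trans h3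

/-! ## All sufficiently large `L` -/

open Filter Topology in
/-- the error coefficient `ε(L, d) → 0` as `L → ∞`. [folklore] -/
theorem tendsto_errCoeff (d : ℤ × ℤ) :
    Tendsto (fun L : ℕ => 2 * (rhoMax d * (11.71 * Real.log L + 5.9) / (L : ℝ) ^ 2)
      + 4 * (((15 / 2 * (Real.pi ^ 2 / 2 + Real.pi ^ 4 / 4) + 3 * Real.pi ^ 2 / 16)) * rhoMax d) / L) atTop (𝓝 0) := by
  have h1 : Tendsto (fun x : ℝ => Real.log x / x) atTop (𝓝 0) := by
    have := Real.tendsto_pow_log_div_mul_add_atTop 1 0 1 one_ne_zero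
    simpa using this
  have hlog : Tendsto (fun L : ℕ => Real.log L / (L : ℝ)) atTop (𝓝 0) := h1.comp tendsto_natCast_atTop_atTop
  have hinv : Tendsto (fun L : ℕ => 1 / (L : ℝ)) atTop (𝓝 0) := tendsto_one_div_atTop_nhds_zero_nat
  set C := (15 / 2 * (Real.pi ^ 2 / 2 + Real.pi ^ 4 / 4) + 3 * Real.pi ^ 2 / 16) with hC
  have key := (((tendsto_const_nhds (x := 2 * rhoMax d * 11.71)).mul (hlog.mul hinv)).add
    ((tendsto_const_nhds (x := 2 * rhoMax d * 5.9)).mul (hinv.mul hinv))).add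
    ((tendsto_const_nhds (x := 4 * (C * rhoMax d))).mul hinv)
  simp only [mul_zero, add_zero] at key
  refine key.congr' ?_
  filter_upwards [Filter.eventually_gt_atTop 0] with L hL0
  have hLr : (L : ℝ) ≠ 0 := by exact_mod_cast hL0.ne'
  field_simp

/-- ★★★ **NEAR-PAIR HOLE₂(.75) CERTIFICATE FOR ALL LARGE `L`:** given the three `L`-free facts about the explicit ℤ² skeleton of the
offset `d` (invertible, `s > 0`, margin `ε₀·Ninf² ≤ wᵀP∞w` with some `ε₀ > 0`), there is an `L₀` such that
`DualCert L (¾ε₁) z (z + d)` holds for every `L ≥ L₀` and every `z`. [folklore] -/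
theorem dualCert_threeQuarter_near_eventually (d : ℤ × ℤ) (ε₀ : ℝ) (hε₀ : 0 < ε₀)
    (hA : IsUnit (skelA d).det) (hs : 0 < TwoChannel.svec2 (skelA d))
    (hpos : ∀ w : Fin 4 ⊕ Fin 4 → ℝ,
      ε₀ * (Ninf (skelA d) w) ^ 2 ≤ dotProduct w ((twoHolePinf (skelA d)).mulVec w)) :
    ∃ L₀ : ℕ, ∀ (M : ℕ) [NeZero M], L₀ ≤ M → ∀ z : Tor M, DualCert M (3 / 4 * eps1 M) z (z + castPt M d) := by
  obtain ⟨N₁, hN₁⟩ := Filter.eventually_atTop.mp ((tendsto_errCoeff d).eventually (Iic_mem_nhds hε₀))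
  set s := TwoChannel.svec2 (skelA d) with hsdef
  set N₂ : ℕ := 2 * ⌈Real.exp (1 / (2 * s))⌉₊ with hN₂
  refine ⟨max 8 (max N₁ N₂), fun M _ hM z => ?_⟩
  have h8 : 8 ≤ M := le_trans (le_max_left _ _) hM
  have hM1 : N₁ ≤ M := le_trans ((le_max_left _ _).trans (le_max_right _ _)) hM
  have hM2 : N₂ ≤ M := le_trans ((le_max_right _ _).trans (le_max_right _ _)) hM
  refine dualCert_threeQuarter_near_inf M h8 z d ε₀ hA hs ?_ (hN₁ M hM1) hpos
  -- the capacity threshold `2 ≤ 4 H_{⌊M/2⌋} s`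
  have hdiv : ⌈Real.exp (1 / (2 * s))⌉₊ ≤ M / 2 := by
    rw [Nat.le_div_iff_mul_le two_pos]
    omega
  have hH : 1 / (2 * s) ≤ (harmonic (M / 2) : ℝ) := by
    have hh := log_add_one_le_harmonic (M / 2)
    have hc : Real.exp (1 / (2 * s)) ≤ ((M / 2 + 1 : ℕ) : ℝ) := by
      have h1 := Nat.le_ceil (Real.exp (1 / (2 * s)))
      have h2 : (⌈Real.exp (1 / (2 * s))⌉₊ : ℝ) ≤ ((M / 2 : ℕ) : ℝ) := by exact_mod_cast hdiv
      push_cast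
      linarith
    calc 1 / (2 * s) = Real.log (Real.exp (1 / (2 * s))) := (Real.log_exp _).symm
      _ ≤ Real.log ((M / 2 + 1 : ℕ) : ℝ) := Real.log_le_log (Real.exp_pos _) hc
      _ ≤ harmonic (M / 2) := hh
  have h4 : 0 ≤ 4 * s := by positivity
  calc (2 : ℝ) = 1 / (2 * s) * (4 * s) := by field_simp; ring
    _ ≤ (harmonic (M / 2) : ℝ) * (4 * s) := mul_le_mul_of_nonneg_right hH h4
    _ = 4 * (harmonic (M / 2) : ℝ) * s := by ring

end TwoHoleBS

end Summit.HubbardSuperconductivity.HubbardSuperconductivity.Theorems.AnisotropyChord.Transfer.Fibre3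

end
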